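import Literature.Barriers.CriticalPhenomena.RigorousRGSmallParameterHeatKernel
import Literature.Barriers.CriticalPhenomena.LaceExpansionGaussianIntegrals
import HarnessLib

/-!
# `RigorousRGSmallParameter` (Slade, Theorem 1.4.1): simple random walk estimates, II —
# the lazy walk, Gaussian upper bound and near-diagonal lower bound for the heat kernel

Second support file for the proof of Slade's **Lemma 2.1.1** (named fact
`LongRangePhi4.Slade2017_lem211`; source: G. Slade, CMP 358 (2018), arXiv:1611.06169, §2.1.1,
arXiv p. 9). The printed proof quotes from [GT02] (Grigor'yan–Telcs) the heat kernel estimate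
"`c n^{-d/2} e^{-|x|²/cn} ≤ (Dⁿ)_{0,x} ≤ C n^{-d/2} e^{-|x|²/Cn}` for `n` and `x` of the same
parity with `0 < |x|_∞ ≤ n`" for the `n`-step law `pₙ = (Dⁿ)_{0,·}` of simple random walk, and
uses of it exactly: the upper bound for all `n`, and the lower bound in the diffusive window
`n ∈ [|x|², 2|x|²]`. This file proves a Gaussian upper bound for all `n, x`, and the near-diagonal
lower bound in an averaged form (for the lazy walk, which smears out the parity constraint);
that is what the proof of Lemma 2.1.1 in `RigorousRGSmallParameterFracLaplacianDecay.lean`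
consumes.

The tool is the **lazy** walk `p^L_n = Σ_m (n choose m) 2^{-n} p_m`, whose Fourier symbol
`ν(k) = (1 + μ(k))/2 = d⁻¹ Σ_j cos²(k_j/2)` (with `μ(k) = d⁻¹Σ_j cos k_j`, `avgCos`) satisfies
`0 ≤ ν ≤ 1` and `ν(k) ≤ exp(-|k|²/(dπ²))` on the whole Brillouin zone (Jordan's inequality) — it
has no singularity at the corner `k = (π,…,π)` of the zone, unlike `|μ|`.

## Contents (all PROVED, `[folklore]`)

* `lazySymbol`, `lazyLaw` and the Fourier representation
  `∫_{[-π,π]^d} ν(k)ⁿ cos(k·x) dk = (2π)^d p^L_n(x)` (`setIntegral_lazySymbol_pow_mul_cos`);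
* `lazySymbol_le_exp` (`ν ≤ e^{-|k|²/(dπ²)}`), `one_sub_le_lazySymbol` (`ν ≥ 1 - |k|²/(4d)`);
* `lazyLaw_zero_le` — `p^L_n(0) ≤ (dπ/4)^{d/2} n^{-d/2}` (comparison with the Gaussian integral on
  `ℝ^d`); `le_lazyLaw_zero` — `p^L_n(0) ≥ (3/4)π^{-d} n^{-d/2}` (the cube of side `2/√n` and
  Bernoulli's inequality); `lazyLaw_zero_sub_le` —
  `p^L_n(0) - p^L_n(x) ≤ C_d |x|₁ n^{-(d+1)/2}` (`1 - cos u ≤ |u|` and a Gaussian first moment);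
  `exists_lazyLaw_ge` — hence `p^L_n(x) ≥ c n^{-d/2}` whenever `|x|₁ ≤ ε√n`;
* `srwLaw_even_zero_antitone` (`p_{2m}(0) ≤ p_{2i}(0)`, `i ≤ m`), `srwLaw_even_zero_le_two_mul`
  (`p_{2m}(0) ≤ 2 p^L_{2m}(0)`, by `Σ_i (2m choose i)(1 + (-1)^i) = 2^{2m}`), and the on-diagonal
  bound `exists_srwLaw_le_rpow` — `pₙ(x) ≤ K n^{-d/2}` for all `n ≥ 1`, `x`;
* **`exists_srwLaw_gaussian_upper`** — `pₙ(x) ≤ C n^{-d/2} e^{-x_j²/(8n)}` for all `n ≥ 1`, `x`,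
  `j` (split the walk at time `⌊n/2⌋`: `srwLaw_add_le_split` with the Chernoff tails of
  `RigorousRGSmallParameterHeatKernel.lean`).
-/

noncomputable section

namespace Literature.Barriers.CriticalPhenomena

open _root_.MeasureTheory Finset Filter Literature.Probability.LatticeModels
open scoped _root_.Topology BigOperators Nat

namespace LongRangePhi4

variable {d : ℕ}

/-! ### The lazy symbol `ν = (1 + μ)/2` -/

/-- The Fourier symbol of the lazy simple random walk (hold with probability `1/2`):
`ν(k) = d⁻¹ Σ_j cos²(k_j/2) = (1 + μ(k))/2`. [folklore] -/
def lazySymbol (d : ℕ) (k : Fin d → ℝ) : ℝ := (∑ j, Real.cos (k j / 2) ^ 2) / d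

/-- `ν = (1 + μ)/2`. [folklore] -/
theorem lazySymbol_eq (hd : 1 ≤ d) (k : Fin d → ℝ) : lazySymbol d k = (1 + avgCos d k) / 2 := by
  have hd' : (d : ℝ) ≠ 0 := by exact_mod_cast (Nat.one_le_iff_ne_zero.1 hd)
  unfold lazySymbol avgCos
  have h : ∀ j, Real.cos (k j / 2) ^ 2 = (1 + Real.cos (k j)) / 2 := by
    intro j
    rw [Real.cos_sq, show 2 * (k j / 2) = k j by ring]
    ring
  simp_rw [h]
  rw [← Finset.sum_div, Finset.sum_add_distrib, Finset.sum_const, Finset.card_univ,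
    Fintype.card_fin, nsmul_eq_mul, mul_one]
  field_simp

/-- `0 ≤ ν`. [folklore] -/
theorem lazySymbol_nonneg (k : Fin d → ℝ) : 0 ≤ lazySymbol d k :=
  div_nonneg (Finset.sum_nonneg fun _ _ => sq_nonneg _) (Nat.cast_nonneg d)

/-- `ν ≤ 1`. [folklore] -/
theorem lazySymbol_le_one (k : Fin d → ℝ) : lazySymbol d k ≤ 1 := by
  unfold lazySymbol
  rcases Nat.eq_zero_or_pos d with hd | hd
  · subst hd
    simp
  · have hd' : (0 : ℝ) < d := by exact_mod_cast hd
    rw [div_le_one hd']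
    calc ∑ j, Real.cos (k j / 2) ^ 2 ≤ ∑ _j : Fin d, (1 : ℝ) :=
          Finset.sum_le_sum fun j _ => by
            rw [sq_le_one_iff_abs_le_one]
            exact Real.abs_cos_le_one _
      _ = d := by simp

/-- `ν` is continuous. [folklore] -/
theorem continuous_lazySymbol : Continuous (lazySymbol d) := by
  unfold lazySymbol
  fun_prop

/-- Jordan's inequality in squared form: `(u/π)² ≤ sin²(u/2)` for `|u| ≤ π`. [folklore] -/
theorem sq_div_pi_sq_le_sin_sq_half {u : ℝ} (hu : |u| ≤ Real.pi) :
    u ^ 2 / Real.pi ^ 2 ≤ Real.sin (u / 2) ^ 2 := by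
  have hπ := Real.pi_pos
  have h1 : Real.sin (u / 2) ^ 2 = Real.sin (|u| / 2) ^ 2 := by
    rcases abs_choice u with h | h <;> rw [h]
    rw [neg_div, Real.sin_neg, neg_sq]
  rw [h1]
  have hj := Real.mul_le_sin (by positivity : 0 ≤ |u| / 2) (by linarith : |u| / 2 ≤ Real.pi / 2)
  have e : 2 / Real.pi * (|u| / 2) = |u| / Real.pi := by field_simp
  rw [e] at hj
  have h0 : 0 ≤ |u| / Real.pi := by positivity
  calc u ^ 2 / Real.pi ^ 2 = (|u| / Real.pi) ^ 2 := by rw [div_pow, sq_abs]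
    _ ≤ Real.sin (|u| / 2) ^ 2 := pow_le_pow_left₀ h0 hj 2

/-- **`ν(k) ≤ exp(-|k|²/(dπ²))` on the Brillouin zone** (`d ≥ 1`): `cos²(k_j/2) = 1 - sin²(k_j/2)
≤ 1 - k_j²/π²` by Jordan's inequality, and `1 - s ≤ e^{-s}`. [folklore] -/
theorem lazySymbol_le_exp (hd : 1 ≤ d) {k : Fin d → ℝ} (hk : k ∈ brillouin d) :
    lazySymbol d k ≤ Real.exp (-((1 / ((d : ℝ) * Real.pi ^ 2)) * ∑ j, k j ^ 2)) := by
  have hd' : (0 : ℝ) < d := by exact_mod_cast hd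
  have hπ := Real.pi_pos
  have hkj : ∀ j, |k j| ≤ Real.pi := fun j => abs_le.2 (hk j (Set.mem_univ j))
  have h1 : lazySymbol d k ≤ 1 - (1 / ((d : ℝ) * Real.pi ^ 2)) * ∑ j, k j ^ 2 := by
    unfold lazySymbol
    rw [div_le_iff₀ hd', sub_mul, one_mul, Finset.mul_sum, Finset.sum_mul]
    have h : ∀ j, Real.cos (k j / 2) ^ 2 ≤ 1 - k j ^ 2 / Real.pi ^ 2 := by
      intro j
      rw [Real.cos_sq']
      linarith [sq_div_pi_sq_le_sin_sq_half (hkj j)]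
    calc ∑ j, Real.cos (k j / 2) ^ 2 ≤ ∑ j, (1 - k j ^ 2 / Real.pi ^ 2) :=
          Finset.sum_le_sum fun j _ => h j
      _ = d - ∑ j, 1 / ((d : ℝ) * Real.pi ^ 2) * k j ^ 2 * d := by
          rw [Finset.sum_sub_distrib, Finset.sum_const, Finset.card_univ, Fintype.card_fin,
            nsmul_eq_mul, mul_one]
          congr 1
          refine Finset.sum_congr rfl fun j _ => ?_
          field_simp
  refine h1.trans ?_
  have := Real.add_one_le_exp (-((1 / ((d : ℝ) * Real.pi ^ 2)) * ∑ j, k j ^ 2))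
  linarith

/-- **`ν(k) ≥ 1 - |k|²/(4d)`** (`d ≥ 1`): `cos²(u) = 1 - sin²u ≥ 1 - u²`. [folklore] -/
theorem one_sub_le_lazySymbol (hd : 1 ≤ d) (k : Fin d → ℝ) :
    1 - (∑ j, k j ^ 2) / (4 * d) ≤ lazySymbol d k := by
  have hd' : (0 : ℝ) < d := by exact_mod_cast hd
  unfold lazySymbol
  rw [le_div_iff₀ hd', sub_mul, one_mul]
  have h : ∀ j, 1 - (k j / 2) ^ 2 ≤ Real.cos (k j / 2) ^ 2 := by
    intro j
    rw [Real.cos_sq']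
    linarith [Real.sin_sq_le_sq (x := k j / 2)]
  calc (d : ℝ) - (∑ j, k j ^ 2) / (4 * d) * d = ∑ j : Fin d, (1 - (k j / 2) ^ 2) := by
        rw [Finset.sum_sub_distrib, Finset.sum_const, Finset.card_univ, Fintype.card_fin,
          nsmul_eq_mul, mul_one, Finset.sum_div, Finset.sum_mul]
        congr 1
        refine Finset.sum_congr rfl fun j _ => ?_
        field_simp
        ring
    _ ≤ ∑ j, Real.cos (k j / 2) ^ 2 := Finset.sum_le_sum fun j _ => h j

/-! ### The lazy walk and its Fourier representation -/

/-- The `n`-step law of the **lazy** simple random walk (hold with probability `1/2`, else a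
simple random walk step): `p^L_n(x) = Σ_{m=0}^{n} (n choose m) 2^{-n} p_m(x)`. [folklore] -/
def lazyLaw (d n : ℕ) (x : Site d) : ℝ :=
  ∑ m ∈ Finset.range (n + 1), ((n.choose m : ℝ) / 2 ^ n) * srwLaw d m x

/-- `p^L_n ≥ 0`. [folklore] -/
theorem lazyLaw_nonneg (n : ℕ) (x : Site d) : 0 ≤ lazyLaw d n x :=
  Finset.sum_nonneg fun m _ => mul_nonneg (by positivity) (srwLaw_nonneg m x)

/-- `νⁿ = Σ_m (n choose m) 2^{-n} μ^m` (binomial theorem). [folklore] -/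
theorem lazySymbol_pow_eq_sum (hd : 1 ≤ d) (k : Fin d → ℝ) (n : ℕ) :
    lazySymbol d k ^ n =
      ∑ m ∈ Finset.range (n + 1), ((n.choose m : ℝ) / 2 ^ n) * avgCos d k ^ m := by
  rw [lazySymbol_eq hd, div_pow, add_comm, add_pow, Finset.sum_div]
  refine Finset.sum_congr rfl fun m _ => ?_
  rw [one_pow, mul_one]
  ring

/-- **Fourier representation of the lazy walk**:
`∫_{[-π,π]^d} ν(k)ⁿ cos(k·x) dk = (2π)^d p^L_n(x)` (`d ≥ 1`). [folklore] -/
theorem setIntegral_lazySymbol_pow_mul_cos (hd : 1 ≤ d) (n : ℕ) (x : Site d) :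
    ∫ k in brillouin d, lazySymbol d k ^ n * Real.cos (phase k x) =
      (2 * Real.pi) ^ d * lazyLaw d n x := by
  simp_rw [lazySymbol_pow_eq_sum hd, Finset.sum_mul]
  rw [integral_finsetSum _ fun m _ => ?_]
  · unfold lazyLaw
    rw [Finset.mul_sum]
    refine Finset.sum_congr rfl fun m _ => ?_
    simp_rw [mul_assoc]
    rw [integral_const_mul, setIntegral_avgCos_pow_mul_cos hd m x]
    ring
  · simp_rw [mul_assoc]
    exact (integrableOn_brillouin_of_continuous ((continuous_avgCos.pow m).mul
      (Real.continuous_cos.comp (continuous_phase x)))).const_mul _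

/-- At the origin: `∫_{[-π,π]^d} ν(k)ⁿ dk = (2π)^d p^L_n(0)`. [folklore] -/
theorem setIntegral_lazySymbol_pow (hd : 1 ≤ d) (n : ℕ) :
    ∫ k in brillouin d, lazySymbol d k ^ n = (2 * Real.pi) ^ d * lazyLaw d n 0 := by
  rw [← setIntegral_lazySymbol_pow_mul_cos hd n 0]
  refine integral_congr_ae (Filter.Eventually.of_forall fun k => ?_)
  simp [phase]

/-! ### Upper and lower bounds at the origin -/

/-- **`p^L_n(0) ≤ (dπ/4)^{d/2} n^{-d/2}`** (`n, d ≥ 1`): bound `νⁿ ≤ e^{-n|k|²/(dπ²)}` and extend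
the integral to `ℝ^d`, where `∫ e^{-b|k|²} = (π/b)^{d/2}`. [folklore] -/
theorem lazyLaw_zero_le (hd : 1 ≤ d) {n : ℕ} (hn : 1 ≤ n) :
    lazyLaw d n 0 ≤ ((d : ℝ) * Real.pi / 4) ^ ((d : ℝ) / 2) * (n : ℝ) ^ (-((d : ℝ) / 2)) := by
  have hd' : (0 : ℝ) < d := by exact_mod_cast hd
  have hn' : (0 : ℝ) < n := by exact_mod_cast hn
  have hπ := Real.pi_pos
  have h2π : (0 : ℝ) < (2 * Real.pi) ^ d := by positivity
  set b : ℝ := (n : ℝ) * (1 / ((d : ℝ) * Real.pi ^ 2)) with hb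
  have hb0 : 0 < b := by positivity
  -- pointwise on the zone
  have hpt : ∀ k ∈ brillouin d, lazySymbol d k ^ n ≤ Real.exp (-b * ∑ j, k j ^ 2) := by
    intro k hk
    calc lazySymbol d k ^ n
        ≤ Real.exp (-((1 / ((d : ℝ) * Real.pi ^ 2)) * ∑ j, k j ^ 2)) ^ n :=
          pow_le_pow_left₀ (lazySymbol_nonneg k) (lazySymbol_le_exp hd hk) n
      _ = Real.exp (-b * ∑ j, k j ^ 2) := by
          rw [← Real.exp_nat_mul, hb]
          congr 1
          ring
  have hint : IntegrableOn (fun k => lazySymbol d k ^ n) (brillouin d) :=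
    integrableOn_brillouin_of_continuous (continuous_lazySymbol.pow n)
  have hG := integrable_exp_neg_mul_sum_sq (d := d) hb0
  have h1 : (∫ k in brillouin d, lazySymbol d k ^ n) ≤ ∫ k in brillouin d, Real.exp (-b * ∑ j, k j ^ 2) :=
    setIntegral_mono_on hint hG.integrableOn (measurableSet_brillouin d) hpt
  have h2 : (∫ k in brillouin d, Real.exp (-b * ∑ j, k j ^ 2)) ≤
      ∫ k : Fin d → ℝ, Real.exp (-b * ∑ j, k j ^ 2) :=
    setIntegral_le_integral hG (Filter.Eventually.of_forall fun k => (Real.exp_pos _).le)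
  rw [integral_exp_neg_mul_sum_sq hb0] at h2
  have h3 := (h1.trans h2)
  rw [setIntegral_lazySymbol_pow hd n] at h3
  -- `(π/b)^{d/2} = (2π)^d (dπ)^{d/2} ... ` : solve for `p^L_n(0)`
  have e : (Real.pi / b) ^ ((d : ℝ) / 2) =
      (2 * Real.pi) ^ d * (((d : ℝ) * Real.pi / 4) ^ ((d : ℝ) / 2) * (n : ℝ) ^ (-((d : ℝ) / 2))) := by
    have e1 : Real.pi / b = (2 * Real.pi) ^ (2 : ℝ) * ((d : ℝ) * Real.pi / 4) * (n : ℝ)⁻¹ := by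
      rw [hb]
      field_simp
      norm_num
      ring
    rw [e1, Real.mul_rpow (by positivity) (by positivity), Real.mul_rpow (by positivity) (by positivity),
      ← Real.rpow_mul (by positivity), show (2 : ℝ) * ((d : ℝ) / 2) = d by ring, Real.rpow_natCast,
      Real.inv_rpow hn'.le, ← Real.rpow_neg hn'.le]
    ring
  rw [e] at h3
  exact le_of_mul_le_mul_left h3 h2π

/-- The small cube `[-s, s]^d` with `s ≤ π` lies in the Brillouin zone. [folklore] -/
theorem smallCube_subset_brillouin {s : ℝ} (hs : s ≤ Real.pi) :
    Set.Icc (fun _ : Fin d => -s) (fun _ => s) ⊆ brillouin d := by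
  intro k hk j _
  rw [Set.mem_Icc] at hk
  exact ⟨by linarith [hk.1 j], by linarith [hk.2 j]⟩

/-- **`p^L_n(0) ≥ (3/4) π^{-d} n^{-d/2}`** (`n, d ≥ 1`): on the cube of side `2/√n`,
`ν ≥ 1 - 1/(4n)`, so `νⁿ ≥ 3/4` by Bernoulli's inequality. [folklore] -/
theorem le_lazyLaw_zero (hd : 1 ≤ d) {n : ℕ} (hn : 1 ≤ n) :
    (3 / 4) * (Real.pi ^ d)⁻¹ * (n : ℝ) ^ (-((d : ℝ) / 2)) ≤ lazyLaw d n 0 := by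
  have hd' : (0 : ℝ) < d := by exact_mod_cast hd
  have hn' : (1 : ℝ) ≤ n := by exact_mod_cast hn
  have hn0 : (0 : ℝ) < n := by linarith
  have hπ := Real.pi_pos
  have h2π : (0 : ℝ) < (2 * Real.pi) ^ d := by positivity
  set s : ℝ := (Real.sqrt n)⁻¹ with hs
  have hs0 : 0 < s := inv_pos.2 (Real.sqrt_pos.2 hn0)
  have hs1 : s ≤ 1 := by
    rw [hs]
    exact inv_le_one_of_one_le₀ (Real.one_le_sqrt.2 hn')
  have hsπ : s ≤ Real.pi := hs1.trans (by linarith [Real.pi_gt_three])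
  have hs2 : s ^ 2 = (n : ℝ)⁻¹ := by
    rw [hs, inv_pow, Real.sq_sqrt hn0.le]
  set S : Set (Fin d → ℝ) := Set.Icc (fun _ : Fin d => -s) (fun _ => s) with hS
  have hSsub : S ⊆ brillouin d := smallCube_subset_brillouin hsπ
  have hSm : MeasurableSet S := measurableSet_Icc
  -- on `S`, `νⁿ ≥ 3/4`
  have hpt : ∀ k ∈ S, (3 / 4 : ℝ) ≤ lazySymbol d k ^ n := by
    intro k hk
    rw [hS, Set.mem_Icc] at hk
    have hkj : ∀ j, k j ^ 2 ≤ s ^ 2 := fun j => by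
      have h1 : -s ≤ k j := hk.1 j
      have h2 : k j ≤ s := hk.2 j
      nlinarith
    have hsum : ∑ j, k j ^ 2 ≤ d * s ^ 2 := by
      calc ∑ j, k j ^ 2 ≤ ∑ _j : Fin d, s ^ 2 := Finset.sum_le_sum fun j _ => hkj j
        _ = d * s ^ 2 := by simp
    have hν : 1 + -(1 / (4 * (n : ℝ))) ≤ lazySymbol d k := by
      refine le_trans ?_ (one_sub_le_lazySymbol hd k)
      rw [hs2] at hsum
      have : (∑ j, k j ^ 2) / (4 * d) ≤ 1 / (4 * n) := by
        rw [div_le_div_iff₀ (by positivity) (by positivity)]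
        calc (∑ j, k j ^ 2) * (4 * n) ≤ (d : ℝ) * (n : ℝ)⁻¹ * (4 * n) :=
              mul_le_mul_of_nonneg_right hsum (by positivity)
          _ = 1 * (4 * d) := by field_simp
      linarith
    have hB := one_add_mul_le_pow (by
      have : (0 : ℝ) < 4 * n := by positivity
      have : 1 / (4 * (n : ℝ)) ≤ 1 := by
        rw [div_le_one this]; linarith
      linarith : (-2 : ℝ) ≤ -(1 / (4 * (n : ℝ)))) n
    have h34 : (1 : ℝ) + n * -(1 / (4 * (n : ℝ))) = 3 / 4 := by field_simp; ring
    rw [h34] at hB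
    have h0 : 0 ≤ 1 + -(1 / (4 * (n : ℝ))) := by
      have : 1 / (4 * (n : ℝ)) ≤ 1 / 4 := by
        rw [div_le_div_iff₀ (by positivity) (by positivity)]; linarith
      linarith
    exact hB.trans (pow_le_pow_left₀ h0 hν n)
  have hint : IntegrableOn (fun k => lazySymbol d k ^ n) (brillouin d) :=
    integrableOn_brillouin_of_continuous (continuous_lazySymbol.pow n)
  have h1 : (∫ _k in S, (3 / 4 : ℝ)) ≤ ∫ k in S, lazySymbol d k ^ n :=
    setIntegral_mono_on (integrableOn_const ?_) (hint.mono_set hSsub) hSm hpt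
  swap
  · exact ((measure_mono hSsub).trans_lt (isCompact_brillouin d).measure_lt_top).ne
  have h2 : (∫ k in S, lazySymbol d k ^ n) ≤ ∫ k in brillouin d, lazySymbol d k ^ n :=
    setIntegral_mono_set hint (Filter.Eventually.of_forall fun k => pow_nonneg (lazySymbol_nonneg k) n)
      (Filter.Eventually.of_forall hSsub)
  have hvol : ∫ _k in S, (3 / 4 : ℝ) = (2 * s) ^ d * (3 / 4) := by
    rw [setIntegral_const, smul_eq_mul, Measure.real, hS,
      Real.volume_Icc_pi_toReal (fun _ => by linarith)]
    simp only [sub_neg_eq_add, Finset.prod_const, Finset.card_univ, Fintype.card_fin]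
    ring
  have h3 := h1.trans h2
  rw [hvol, setIntegral_lazySymbol_pow hd n] at h3
  -- `(2s)^d (3/4) = (2π)^d · (3/4) π^{-d} n^{-d/2}`
  have e : (2 * s) ^ d * (3 / 4) =
      (2 * Real.pi) ^ d * ((3 / 4) * (Real.pi ^ d)⁻¹ * (n : ℝ) ^ (-((d : ℝ) / 2))) := by
    have hsd : s ^ d = (n : ℝ) ^ (-((d : ℝ) / 2)) := by
      rw [hs, Real.sqrt_eq_rpow, ← Real.rpow_neg_one, ← Real.rpow_mul hn0.le, ← Real.rpow_natCast,
        ← Real.rpow_mul hn0.le]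
      congr 1
      ring
    rw [mul_pow, mul_pow, hsd]
    field_simp
  rw [e] at h3
  exact le_of_mul_le_mul_left h3 h2π

/-! ### Off-diagonal comparison for the lazy walk -/

/-- `1 - cos u ≤ |u|`. [folklore] -/
theorem one_sub_cos_le_abs (u : ℝ) : 1 - Real.cos u ≤ |u| := by
  rcases le_or_gt |u| 2 with h | h
  · have h1 := Real.one_sub_sq_div_two_le_cos (x := u)
    have h2 : u ^ 2 ≤ 2 * |u| := by
      rw [← sq_abs]
      nlinarith [abs_nonneg u]
    nlinarith
  · linarith [Real.neg_one_le_cos u]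

/-- `|k·x| ≤ Σ_j |x_j| |k_j|`. [folklore] -/
theorem abs_phase_le (k : Fin d → ℝ) (x : Site d) :
    |phase k x| ≤ ∑ j, |((x j : ℤ) : ℝ)| * |k j| := by
  unfold phase
  refine (Finset.abs_sum_le_sum_abs _ _).trans (le_of_eq ?_)
  refine Finset.sum_congr rfl fun j _ => ?_
  rw [abs_mul, mul_comm]

/-- **Off-diagonal comparison**: `p^L_n(0) - p^L_n(x) ≤ C_d (Σ_j |x_j|) n^{-(d+1)/2}` with
`C_d = (2π)^{-d} (dπ²) (dπ³)^{(d-1)/2}` (`n, d ≥ 1`): `(2π)^d(p^L_n(0) - p^L_n(x)) =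
∫ νⁿ(1 - cos k·x) ≤ Σ_j |x_j| ∫ νⁿ|k_j| ≤ Σ_j |x_j| ∫_{ℝ^d} |k_j| e^{-n|k|²/(dπ²)}`. [folklore] -/
theorem lazyLaw_zero_sub_le (hd : 1 ≤ d) {n : ℕ} (hn : 1 ≤ n) (x : Site d) :
    lazyLaw d n 0 - lazyLaw d n x ≤
      ((2 * Real.pi) ^ d)⁻¹ * (((d : ℝ) * Real.pi ^ 2) * ((d : ℝ) * Real.pi ^ 3) ^ (((d : ℝ) - 1) / 2)) *
        (∑ j, |((x j : ℤ) : ℝ)|) * (n : ℝ) ^ (-(((d : ℝ) + 1) / 2)) := by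
  have hd' : (0 : ℝ) < d := by exact_mod_cast hd
  have hn' : (0 : ℝ) < n := by exact_mod_cast hn
  have hπ := Real.pi_pos
  have h2π : (0 : ℝ) < (2 * Real.pi) ^ d := by positivity
  set b : ℝ := (n : ℝ) * (1 / ((d : ℝ) * Real.pi ^ 2)) with hb
  have hb0 : 0 < b := by positivity
  -- the difference as one integral
  have hcont : ∀ y : Site d, Continuous fun k => lazySymbol d k ^ n * Real.cos (phase k y) := fun y =>
    (continuous_lazySymbol.pow n).mul (Real.continuous_cos.comp (continuous_phase y))
  have hi1 : IntegrableOn (fun k => lazySymbol d k ^ n) (brillouin d) :=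
    integrableOn_brillouin_of_continuous (continuous_lazySymbol.pow n)
  have hi2 : IntegrableOn (fun k => lazySymbol d k ^ n * Real.cos (phase k x)) (brillouin d) :=
    integrableOn_brillouin_of_continuous (hcont x)
  have hdiff : (2 * Real.pi) ^ d * (lazyLaw d n 0 - lazyLaw d n x) =
      ∫ k in brillouin d, lazySymbol d k ^ n * (1 - Real.cos (phase k x)) := by
    rw [mul_sub, ← setIntegral_lazySymbol_pow hd n, ← setIntegral_lazySymbol_pow_mul_cos hd n x,
      ← integral_sub hi1 hi2]
    refine integral_congr_ae (Filter.Eventually.of_forall fun k => ?_)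
    ring
  -- pointwise domination by `Σ_j |x_j| |k_j| e^{-b|k|²}`
  set g : (Fin d → ℝ) → ℝ := fun k => ∑ j, |((x j : ℤ) : ℝ)| * (|k j| ^ (1 : ℝ) * Real.exp (-b * ∑ i, k i ^ 2))
    with hg
  have hgint : Integrable g := by
    refine integrable_finsetSum _ fun j _ => Integrable.const_mul ?_ _
    exact (integral_abs_apply_rpow_mul_exp_neg_mul_sum_sq hd hb0 zero_le_one j).1
  have hgnn : ∀ k, 0 ≤ g k := fun k => Finset.sum_nonneg fun j _ =>
    mul_nonneg (abs_nonneg _) (mul_nonneg (Real.rpow_nonneg (abs_nonneg _) _) (Real.exp_pos _).le)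
  have hpt : ∀ k ∈ brillouin d, lazySymbol d k ^ n * (1 - Real.cos (phase k x)) ≤ g k := by
    intro k hk
    have hνn : lazySymbol d k ^ n ≤ Real.exp (-b * ∑ i, k i ^ 2) := by
      calc lazySymbol d k ^ n
          ≤ Real.exp (-((1 / ((d : ℝ) * Real.pi ^ 2)) * ∑ j, k j ^ 2)) ^ n :=
            pow_le_pow_left₀ (lazySymbol_nonneg k) (lazySymbol_le_exp hd hk) n
        _ = Real.exp (-b * ∑ j, k j ^ 2) := by
            rw [← Real.exp_nat_mul, hb]
            congr 1
            ring
    have h1 : 1 - Real.cos (phase k x) ≤ ∑ j, |((x j : ℤ) : ℝ)| * |k j| :=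
      (one_sub_cos_le_abs _).trans (abs_phase_le k x)
    calc lazySymbol d k ^ n * (1 - Real.cos (phase k x))
        ≤ Real.exp (-b * ∑ i, k i ^ 2) * ∑ j, |((x j : ℤ) : ℝ)| * |k j| :=
          mul_le_mul hνn h1 (by linarith [Real.cos_le_one (phase k x)]) (Real.exp_pos _).le
      _ = g k := by
          simp only [hg, Real.rpow_one]
          rw [Finset.mul_sum]
          refine Finset.sum_congr rfl fun j _ => ?_
          ring
  have hI1 : (∫ k in brillouin d, lazySymbol d k ^ n * (1 - Real.cos (phase k x))) ≤
      ∫ k in brillouin d, g k :=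
    setIntegral_mono_on (integrableOn_brillouin_of_continuous ((continuous_lazySymbol.pow n).mul
      (continuous_const.sub (Real.continuous_cos.comp (continuous_phase x)))))
      hgint.integrableOn (measurableSet_brillouin d) hpt
  have hI2 : (∫ k in brillouin d, g k) ≤ ∫ k, g k :=
    setIntegral_le_integral hgint (Filter.Eventually.of_forall hgnn)
  -- evaluate `∫ g`
  have hIg : ∫ k, g k = (∑ j, |((x j : ℤ) : ℝ)|) *
      (b ^ (-((1 : ℝ) + 1) / 2) * Real.Gamma (((1 : ℝ) + 1) / 2) * (Real.pi / b) ^ (((d : ℝ) - 1) / 2)) := by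
    simp only [hg]
    rw [integral_finsetSum _ fun j _ =>
      ((integral_abs_apply_rpow_mul_exp_neg_mul_sum_sq hd hb0 zero_le_one j).1).const_mul _]
    rw [Finset.sum_mul]
    refine Finset.sum_congr rfl fun j _ => ?_
    rw [integral_const_mul, (integral_abs_apply_rpow_mul_exp_neg_mul_sum_sq hd hb0 zero_le_one j).2]
  have hmain := hI1.trans hI2
  rw [← hdiff, hIg] at hmain
  -- simplify the constant: `b^{-1} Γ(1) (π/b)^{(d-1)/2} = (dπ²)(dπ³)^{(d-1)/2} n^{-(d+1)/2}`
  have hΓ : Real.Gamma (((1 : ℝ) + 1) / 2) = 1 := by norm_num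
  have e : b ^ (-((1 : ℝ) + 1) / 2) * Real.Gamma (((1 : ℝ) + 1) / 2) * (Real.pi / b) ^ (((d : ℝ) - 1) / 2) =
      (((d : ℝ) * Real.pi ^ 2) * ((d : ℝ) * Real.pi ^ 3) ^ (((d : ℝ) - 1) / 2)) *
        (n : ℝ) ^ (-(((d : ℝ) + 1) / 2)) := by
    rw [hΓ, mul_one, show -((1 : ℝ) + 1) / 2 = -1 by norm_num, Real.rpow_neg_one]
    have e1 : Real.pi / b = ((d : ℝ) * Real.pi ^ 3) * (n : ℝ)⁻¹ := by
      rw [hb]; field_simp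
    have e2 : b⁻¹ = ((d : ℝ) * Real.pi ^ 2) * (n : ℝ)⁻¹ := by
      rw [hb]; field_simp
    rw [e1, e2, Real.mul_rpow (by positivity) (by positivity), Real.inv_rpow hn'.le,
      ← Real.rpow_neg hn'.le, ← Real.rpow_neg_one n]
    have e3 : (n : ℝ) ^ (-(1 : ℝ)) * (n : ℝ) ^ (-(((d : ℝ) - 1) / 2)) = (n : ℝ) ^ (-(((d : ℝ) + 1) / 2)) := by
      rw [← Real.rpow_add hn']
      congr 1
      ring
    rw [← e3]
    ring
  rw [e] at hmain
  have hmain' := (le_div_iff₀' h2π).2 hmain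
  calc lazyLaw d n 0 - lazyLaw d n x
      ≤ (∑ j, |((x j : ℤ) : ℝ)|) * ((((d : ℝ) * Real.pi ^ 2) * ((d : ℝ) * Real.pi ^ 3) ^ (((d : ℝ) - 1) / 2)) *
          (n : ℝ) ^ (-(((d : ℝ) + 1) / 2))) / (2 * Real.pi) ^ d := hmain'
    _ = _ := by
        rw [div_eq_inv_mul]
        ring

/-- **Near-diagonal lower bound for the lazy walk**: there are `c, ε > 0` (depending on `d`)
with `p^L_n(x) ≥ c n^{-d/2}` whenever `n ≥ 1` and `Σ_j |x_j| ≤ ε √n`. [folklore] -/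
theorem exists_lazyLaw_ge (hd : 1 ≤ d) :
    ∃ c ε : ℝ, 0 < c ∧ 0 < ε ∧ ∀ (n : ℕ), 1 ≤ n → ∀ x : Site d,
      (∑ j, |((x j : ℤ) : ℝ)|) ≤ ε * Real.sqrt n → c * (n : ℝ) ^ (-((d : ℝ) / 2)) ≤ lazyLaw d n x := by
  have hd' : (0 : ℝ) < d := by exact_mod_cast hd
  have hπ := Real.pi_pos
  set c₁ : ℝ := (3 / 4) * (Real.pi ^ d)⁻¹ with hc₁
  set C₂ : ℝ := ((2 * Real.pi) ^ d)⁻¹ *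
    (((d : ℝ) * Real.pi ^ 2) * ((d : ℝ) * Real.pi ^ 3) ^ (((d : ℝ) - 1) / 2)) with hC₂
  have hc₁0 : 0 < c₁ := by positivity
  have hC₂0 : 0 < C₂ := by positivity
  refine ⟨c₁ / 2, c₁ / (2 * C₂), by positivity, by positivity, fun n hn x hx => ?_⟩
  have hn' : (0 : ℝ) < n := by exact_mod_cast hn
  have h1 := le_lazyLaw_zero hd hn
  have h2 := lazyLaw_zero_sub_le hd hn x
  -- `C₂ |x|₁ n^{-(d+1)/2} ≤ (c₁/2) n^{-d/2}` from `|x|₁ ≤ ε √n`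
  have hsplit : (n : ℝ) ^ (-(((d : ℝ) + 1) / 2)) = (n : ℝ) ^ (-((d : ℝ) / 2)) * (Real.sqrt n)⁻¹ := by
    rw [Real.sqrt_eq_rpow, ← Real.rpow_neg hn'.le, ← Real.rpow_add hn']
    congr 1
    ring
  have hsq : 0 < Real.sqrt n := Real.sqrt_pos.2 hn'
  have h3 : C₂ * (∑ j, |((x j : ℤ) : ℝ)|) * (n : ℝ) ^ (-(((d : ℝ) + 1) / 2)) ≤
      c₁ / 2 * (n : ℝ) ^ (-((d : ℝ) / 2)) := by
    rw [hsplit]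
    have hpow : 0 < (n : ℝ) ^ (-((d : ℝ) / 2)) := Real.rpow_pos_of_pos hn' _
    have : C₂ * (∑ j, |((x j : ℤ) : ℝ)|) * (Real.sqrt n)⁻¹ ≤ c₁ / 2 := by
      rw [mul_inv_le_iff₀ hsq]
      calc C₂ * ∑ j, |((x j : ℤ) : ℝ)| ≤ C₂ * (c₁ / (2 * C₂) * Real.sqrt n) :=
            mul_le_mul_of_nonneg_left hx hC₂0.le
        _ = c₁ / 2 * Real.sqrt n := by field_simp
    calc C₂ * (∑ j, |((x j : ℤ) : ℝ)|) * ((n : ℝ) ^ (-((d : ℝ) / 2)) * (Real.sqrt n)⁻¹)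
        = (C₂ * (∑ j, |((x j : ℤ) : ℝ)|) * (Real.sqrt n)⁻¹) * (n : ℝ) ^ (-((d : ℝ) / 2)) := by ring
      _ ≤ (c₁ / 2) * (n : ℝ) ^ (-((d : ℝ) / 2)) := mul_le_mul_of_nonneg_right this hpow.le
  rw [← hC₂] at h2
  have h1' : c₁ * (n : ℝ) ^ (-((d : ℝ) / 2)) ≤ lazyLaw d n 0 := by rw [hc₁]; exact h1
  have h4 := h2.trans h3
  have h5 : c₁ / 2 * (n : ℝ) ^ (-((d : ℝ) / 2)) =
      c₁ * (n : ℝ) ^ (-((d : ℝ) / 2)) - c₁ / 2 * (n : ℝ) ^ (-((d : ℝ) / 2)) := by ring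
  linarith

/-! ### The on-diagonal bound for `pₙ` -/

/-- The even return probabilities decrease: `p_{2m}(0) ≤ p_{2i}(0)` for `i ≤ m` (`d ≥ 1`), since
`(2π)^d p_{2i}(0) = ∫ μ^{2i}` and `0 ≤ μ² ≤ 1`. [folklore] -/
theorem srwLaw_even_zero_antitone (hd : 1 ≤ d) {i m : ℕ} (him : i ≤ m) :
    srwLaw d (2 * m) 0 ≤ srwLaw d (2 * i) 0 := by
  have h2π : (0 : ℝ) < (2 * Real.pi) ^ d := by positivity
  have hi := setIntegral_avgCos_pow_mul_cos hd (2 * i) 0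
  have hm := setIntegral_avgCos_pow_mul_cos hd (2 * m) 0
  simp only [phase, Int.cast_zero, Pi.zero_apply, mul_zero, Finset.sum_const_zero, Real.cos_zero,
    mul_one] at hi hm
  have hle : (∫ k in brillouin d, avgCos d k ^ (2 * m)) ≤ ∫ k in brillouin d, avgCos d k ^ (2 * i) := by
    refine setIntegral_mono_on (integrableOn_brillouin_of_continuous (continuous_avgCos.pow _))
      (integrableOn_brillouin_of_continuous (continuous_avgCos.pow _)) (measurableSet_brillouin d)
      fun k _ => ?_
    rw [pow_mul, pow_mul]
    exact pow_le_pow_of_le_one (sq_nonneg _) ((sq_le_one_iff_abs_le_one _).2 (abs_avgCos_le_one k)) him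
  rw [hi, hm] at hle
  exact le_of_mul_le_mul_left hle h2π

/-- `Σ_{i ≤ n} (n choose i)(1 + (-1)^i)/2 ≥ 2^{n-1}`, in the form
`2^n ≤ Σ_{i ≤ n} (n choose i)(1 + (-1)^i)` (over `ℝ`; equality unless `n = 0`). [folklore] -/
theorem two_pow_le_sum_choose_even (n : ℕ) :
    (2 : ℝ) ^ n ≤ ∑ i ∈ Finset.range (n + 1), (n.choose i : ℝ) * (1 + (-1) ^ i) := by
  have h1 : ∑ i ∈ Finset.range (n + 1), (n.choose i : ℝ) = 2 ^ n := by
    exact_mod_cast Nat.sum_range_choose n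
  have h2 : 0 ≤ ∑ i ∈ Finset.range (n + 1), (n.choose i : ℝ) * (-1) ^ i := by
    have h := (Int.alternating_sum_range_choose (n := n))
    have h' : ∑ i ∈ Finset.range (n + 1), (n.choose i : ℝ) * (-1) ^ i =
        ((∑ m ∈ Finset.range (n + 1), ((-1) ^ m * n.choose m : ℤ) : ℤ) : ℝ) := by
      push_cast
      refine Finset.sum_congr rfl fun i _ => ?_
      ring
    rw [h', h]
    split_ifs <;> simp
  simp_rw [mul_add, mul_one]
  rw [Finset.sum_add_distrib, h1]
  linarith

/-- **`p_{2m}(0) ≤ 2 p^L_{2m}(0)`** (`d ≥ 1`): in `p^L_{2m}(0) = Σ_i (2m choose i) 4^{-m} p_i(0)`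
the even terms have `p_i(0) ≥ p_{2m}(0)` and the odd ones are `≥ 0`, and
`Σ_i (2m choose i)(1 + (-1)^i)/2 = 2^{2m-1}`. [folklore] -/
theorem srwLaw_even_zero_le_two_mul (hd : 1 ≤ d) (m : ℕ) :
    srwLaw d (2 * m) 0 ≤ 2 * lazyLaw d (2 * m) 0 := by
  unfold lazyLaw
  have hpt : ∀ i ∈ Finset.range (2 * m + 1),
      ((2 * m).choose i : ℝ) / 2 ^ (2 * m) * ((1 + (-1) ^ i) / 2 * srwLaw d (2 * m) 0) ≤
        ((2 * m).choose i : ℝ) / 2 ^ (2 * m) * srwLaw d i 0 := by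
    intro i hi
    refine mul_le_mul_of_nonneg_left ?_ (by positivity)
    rcases Nat.even_or_odd i with ⟨l, hl⟩ | ⟨l, hl⟩
    · have hil : i = 2 * l := by omega
      rw [hil, pow_mul, neg_one_sq, one_pow]
      have : l ≤ m := by
        have := Finset.mem_range.1 hi
        omega
      have := srwLaw_even_zero_antitone hd this
      linarith
    · rw [hl, pow_succ, pow_mul, neg_one_sq, one_pow]
      have := srwLaw_nonneg (2 * l + 1) (0 : Site d)
      linarith
  have h1 := Finset.sum_le_sum hpt
  have h2 : ∑ i ∈ Finset.range (2 * m + 1),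
      ((2 * m).choose i : ℝ) / 2 ^ (2 * m) * ((1 + (-1) ^ i) / 2 * srwLaw d (2 * m) 0) =
      (∑ i ∈ Finset.range (2 * m + 1), ((2 * m).choose i : ℝ) * (1 + (-1) ^ i)) *
        (srwLaw d (2 * m) 0 / (2 * 2 ^ (2 * m))) := by
    rw [Finset.sum_mul]
    refine Finset.sum_congr rfl fun i _ => ?_
    ring
  rw [h2] at h1
  have h3 := two_pow_le_sum_choose_even (2 * m)
  have h0 := srwLaw_nonneg (2 * m) (0 : Site d)
  have h4 : (2 : ℝ) ^ (2 * m) * (srwLaw d (2 * m) 0 / (2 * 2 ^ (2 * m))) ≤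
      (∑ i ∈ Finset.range (2 * m + 1), ((2 * m).choose i : ℝ) * (1 + (-1) ^ i)) *
        (srwLaw d (2 * m) 0 / (2 * 2 ^ (2 * m))) :=
    mul_le_mul_of_nonneg_right h3 (by positivity)
  have h5 : (2 : ℝ) ^ (2 * m) * (srwLaw d (2 * m) 0 / (2 * 2 ^ (2 * m))) = srwLaw d (2 * m) 0 / 2 := by
    field_simp
  linarith

/-- **On-diagonal (uniform) bound**: there is `K = K(d)` with `pₙ(x) ≤ K n^{-d/2}` for all
`n ≥ 1` and `x ∈ ℤ^d` (`d ≥ 1`). [folklore] -/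
theorem exists_srwLaw_le_rpow (hd : 1 ≤ d) :
    ∃ K : ℝ, 0 < K ∧ ∀ (n : ℕ), 1 ≤ n → ∀ x : Site d, srwLaw d n x ≤ K * (n : ℝ) ^ (-((d : ℝ) / 2)) := by
  have hd' : (0 : ℝ) < d := by exact_mod_cast hd
  have hπ := Real.pi_pos
  set A : ℝ := ((d : ℝ) * Real.pi / 4) ^ ((d : ℝ) / 2) with hA
  have hA0 : 0 < A := by positivity
  -- `K` covers `n = 1` (`p ≤ 1`) and `n ≥ 2` (`p ≤ 2A (2⌊n/2⌋)^{-d/2} ≤ 2A (n/2)^{-d/2}`... )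
  refine ⟨max 1 (2 * A * (3 : ℝ) ^ ((d : ℝ) / 2)), by positivity, fun n hn x => ?_⟩
  have hn' : (0 : ℝ) < n := by exact_mod_cast hn
  rcases Nat.lt_or_ge n 2 with h1 | h2
  · have hn1 : n = 1 := by omega
    subst hn1
    simp only [Nat.cast_one, Real.one_rpow, mul_one]
    exact (srwLaw_le_one hd 1 x).trans (le_max_left _ _)
  · set m := n / 2 with hm
    have hm1 : 1 ≤ m := by omega
    have hmr : (n : ℝ) / 3 ≤ m := by
      have : n ≤ 3 * m := by omega
      have : (n : ℝ) ≤ 3 * m := by exact_mod_cast this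
      linarith
    have hm0 : (0 : ℝ) < m := by exact_mod_cast hm1
    have h2m : (1 : ℕ) ≤ 2 * m := by omega
    calc srwLaw d n x ≤ srwLaw d (2 * m) 0 := srwLaw_le_srwLaw_even_zero hd n x
      _ ≤ 2 * lazyLaw d (2 * m) 0 := srwLaw_even_zero_le_two_mul hd m
      _ ≤ 2 * (A * ((2 * m : ℕ) : ℝ) ^ (-((d : ℝ) / 2))) :=
          mul_le_mul_of_nonneg_left (lazyLaw_zero_le hd h2m) (by norm_num)
      _ ≤ 2 * (A * ((n : ℝ) / 3) ^ (-((d : ℝ) / 2))) := by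
          refine mul_le_mul_of_nonneg_left (mul_le_mul_of_nonneg_left ?_ hA0.le) (by norm_num)
          refine Real.rpow_le_rpow_of_nonpos (by positivity) ?_ (by
            rw [neg_nonpos]; positivity)
          push_cast
          linarith
      _ = 2 * A * (3 : ℝ) ^ ((d : ℝ) / 2) * (n : ℝ) ^ (-((d : ℝ) / 2)) := by
          rw [Real.div_rpow hn'.le (by norm_num), Real.rpow_neg (by norm_num : (0 : ℝ) ≤ 3), div_inv_eq_mul]
          ring
      _ ≤ max 1 (2 * A * (3 : ℝ) ^ ((d : ℝ) / 2)) * (n : ℝ) ^ (-((d : ℝ) / 2)) :=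
          mul_le_mul_of_nonneg_right (le_max_right _ _) (Real.rpow_nonneg hn'.le _)

/-! ### The Gaussian upper bound -/

/-- A single point is bounded by the tail it belongs to: `pₙ(x) ≤ Σ_{|y_j| ≥ |x_j|} pₙ(y) ≤
2e^{-x_j²/(2n)}` (`n, d ≥ 1`). [folklore] -/
theorem srwLaw_le_two_mul_exp (hd : 1 ≤ d) {n : ℕ} (hn : 1 ≤ n) (x : Site d) (j : Fin d) :
    srwLaw d n x ≤ 2 * Real.exp (-(((x j : ℤ) : ℝ) ^ 2 / (2 * n))) := by
  obtain ⟨hs, hle⟩ := tsum_srwLaw_abs_coord_ge_le hd hn j (abs_nonneg ((x j : ℤ) : ℝ))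
  rw [sq_abs] at hle
  refine le_trans ?_ hle
  have h := hs.le_tsum x (fun y _ => by
    split_ifs
    · exact srwLaw_nonneg n y
    · exact le_rfl)
  rw [if_pos le_rfl] at h
  exact h

/-- **Gaussian upper bound for simple random walk** (the upper half of the [GT02] estimate used
in the proof of Lemma 2.1.1, for all `n ≥ 1` and `x`, coordinatewise): there is `C = C(d)` with
`pₙ(x) ≤ C n^{-d/2} e^{-x_j²/(8n)}` for every coordinate `j`. Proof: split the walk at time
`m = ⌊n/2⌋` (`srwLaw_add_le_split` with `r = |x_j|/2`), bound one factor by the on-diagonal bound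
and the other by the Chernoff tail. [cite: Slade2017, §2.1.1 display (2.10) (upper bound)] -/
theorem exists_srwLaw_gaussian_upper (hd : 1 ≤ d) :
    ∃ C : ℝ, 0 < C ∧ ∀ (n : ℕ), 1 ≤ n → ∀ (x : Site d) (j : Fin d),
      srwLaw d n x ≤ C * (n : ℝ) ^ (-((d : ℝ) / 2)) * Real.exp (-(((x j : ℤ) : ℝ) ^ 2 / (8 * n))) := by
  obtain ⟨K, hK0, hK⟩ := exists_srwLaw_le_rpow hd
  set C : ℝ := max 2 (4 * K * (3 : ℝ) ^ ((d : ℝ) / 2)) with hC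
  refine ⟨C, by positivity, fun n hn x j => ?_⟩
  have hn' : (0 : ℝ) < n := by exact_mod_cast hn
  set a : ℝ := ((x j : ℤ) : ℝ) ^ 2 with ha
  have ha0 : 0 ≤ a := sq_nonneg _
  rcases Nat.lt_or_ge n 2 with h1 | h2
  · -- `n = 1`: the crude tail bound suffices
    have hn1 : n = 1 := by omega
    subst hn1
    have h := srwLaw_le_two_mul_exp hd le_rfl x j
    simp only [Nat.cast_one, mul_one, Real.one_rpow] at h ⊢
    calc srwLaw d 1 x ≤ 2 * Real.exp (-(a / 2)) := h
      _ ≤ C * Real.exp (-(a / 8)) := by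
          refine mul_le_mul (le_max_left _ _) (Real.exp_le_exp.2 (by linarith)) (Real.exp_pos _).le
            (by positivity)
  · set m := n / 2 with hm
    set m' := n - m with hm'
    have hm1 : 1 ≤ m := by omega
    have hm'1 : 1 ≤ m' := by omega
    have hmm' : m + m' = n := by omega
    have hm3 : n ≤ 3 * m := by omega
    have hm'3 : n ≤ 3 * m' := by omega
    have hmn : m ≤ n := by omega
    have hm'n : m' ≤ n := by omega
    have hm0 : (0 : ℝ) < m := by exact_mod_cast hm1
    have hm'0 : (0 : ℝ) < m' := by exact_mod_cast hm'1
    set r : ℝ := |((x j : ℤ) : ℝ)| / 2 with hr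
    have hr0 : 0 ≤ r := by positivity
    have hxr : 2 * r ≤ |((x j : ℤ) : ℝ)| := by rw [hr]; linarith
    have hsplit := srwLaw_add_le_split hd hm1 hm'1 x j hr0 hxr (hK m hm1) (hK m' hm'1)
    rw [hmm'] at hsplit
    obtain ⟨-, hT⟩ := tsum_srwLaw_abs_coord_ge_le hd hm1 j hr0
    obtain ⟨-, hT'⟩ := tsum_srwLaw_abs_coord_ge_le hd hm'1 j hr0
    -- compare `m, m'` with `n`
    have hpow : ∀ l : ℕ, 1 ≤ l → n ≤ 3 * l →
        (l : ℝ) ^ (-((d : ℝ) / 2)) ≤ (3 : ℝ) ^ ((d : ℝ) / 2) * (n : ℝ) ^ (-((d : ℝ) / 2)) := by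
      intro l hl hl3
      have hl0 : (0 : ℝ) < l := by exact_mod_cast hl
      have hle : (n : ℝ) / 3 ≤ l := by
        have : (n : ℝ) ≤ 3 * l := by exact_mod_cast hl3
        linarith
      calc (l : ℝ) ^ (-((d : ℝ) / 2)) ≤ ((n : ℝ) / 3) ^ (-((d : ℝ) / 2)) :=
            Real.rpow_le_rpow_of_nonpos (by positivity) hle (by rw [neg_nonpos]; positivity)
        _ = (3 : ℝ) ^ ((d : ℝ) / 2) * (n : ℝ) ^ (-((d : ℝ) / 2)) := by
            rw [Real.div_rpow hn'.le (by norm_num), Real.rpow_neg (by norm_num : (0 : ℝ) ≤ 3),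
              div_inv_eq_mul, mul_comm]
    have hexp : ∀ l : ℕ, 1 ≤ l → l ≤ n →
        Real.exp (-(r ^ 2 / (2 * l))) ≤ Real.exp (-(a / (8 * n))) := by
      intro l hl hln
      have hl0 : (0 : ℝ) < l := by exact_mod_cast hl
      have hln' : (l : ℝ) ≤ n := by exact_mod_cast hln
      rw [Real.exp_le_exp, neg_le_neg_iff, hr, div_pow, sq_abs, ← ha]
      rw [div_le_div_iff₀ (by positivity) (by positivity)]
      nlinarith
    have hKnn : 0 ≤ K := hK0.le
    calc srwLaw d n x
        ≤ K * (m' : ℝ) ^ (-((d : ℝ) / 2)) * ∑' y : Site d, (if r ≤ |((y j : ℤ) : ℝ)| then srwLaw d m y else 0) +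
          K * (m : ℝ) ^ (-((d : ℝ) / 2)) * ∑' y : Site d, (if r ≤ |((y j : ℤ) : ℝ)| then srwLaw d m' y else 0) :=
          hsplit
      _ ≤ K * ((3 : ℝ) ^ ((d : ℝ) / 2) * (n : ℝ) ^ (-((d : ℝ) / 2))) * (2 * Real.exp (-(a / (8 * n)))) +
          K * ((3 : ℝ) ^ ((d : ℝ) / 2) * (n : ℝ) ^ (-((d : ℝ) / 2))) * (2 * Real.exp (-(a / (8 * n)))) := by
          gcongr
          · exact tsum_nonneg fun y => by split_ifs <;> [exact srwLaw_nonneg m y; exact le_rfl]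
          · exact hpow m' hm'1 hm'3
          · exact hT.trans (mul_le_mul_of_nonneg_left (hexp m hm1 hmn) (by norm_num))
          · exact tsum_nonneg fun y => by split_ifs <;> [exact srwLaw_nonneg m' y; exact le_rfl]
          · exact hpow m hm1 hm3
          · exact hT'.trans (mul_le_mul_of_nonneg_left (hexp m' hm'1 hm'n) (by norm_num))
      _ = (4 * K * (3 : ℝ) ^ ((d : ℝ) / 2)) * (n : ℝ) ^ (-((d : ℝ) / 2)) * Real.exp (-(a / (8 * n))) := by
          ring
      _ ≤ C * (n : ℝ) ^ (-((d : ℝ) / 2)) * Real.exp (-(a / (8 * n))) := by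
          gcongr
          exact le_max_right _ _

end LongRangePhi4

end Literature.Barriers.CriticalPhenomena

end
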